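import Literature.Barriers.CriticalPhenomena.IsingTrivialityFromDimensionFourProofs
import Literature.Probability.LatticeModels.GHSTruncatedVolumeMonotonicity
import Literature.Probability.LatticeModels.MagnetizationExponentUpper
import Literature.Probability.LatticeModels.PlusStateFKG

/-!
# Integrating the susceptibility bound (stub `stub_upperIsothermOfSusceptibility`, line `SketchPub`)

Crux `CoulombImpliesNontrivial` of route `PerfectScreening` (Ising3DConformalLimit), registered stub S6b
(the KNOWN half of the critical-isotherm residual S6): if the truncated two-point function of the plus
state in a field satisfies `Σ_{x∈Λ} ⟨σ₀;σ_x⟩_{β_c,h} · m(β_c,h)⁴ ≤ C` for all finite `Λ` and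
`0 < h ≤ h₀`, then `m(β_c,h) ≤ A h^{1/5}` on `(0, h₀]`, `m(β,h) = magnetizationInField 3 β h = ⟨σ₀⟩⁺_{β,h}`.

Proof (fluctuation–response + GHS + GKS, then calculus).
1. *Truncated plus correlations increase with the volume* (GHS; Lebowitz 1974, Remark (ii): they
   decrease under added fields, and `+` boundary spins are infinite fields) — the tree theorem
   `isingTrunc_plus_mono_volume` (`GHSTruncatedVolumeMonotonicity`, discrete one-site conditioning
   proof) — hence the finite-volume ones are bounded by their plus-state limits
   (`isingTrunc_plus_box_le_plusExpect`, tree `tendsto_isingExpect_plus_spinFun`).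
2. *Fluctuation–response in a plus box* `Λ = box d L` (tree `hasDerivAt_isingExpect_spinAt_field`,
   convention `exp(βΣσσ + βhΣσ)`): `d/ds ⟨σ₀⟩⁺_{Λ,s} = β Σ_{x∈Λ} ⟨σ₀;σ_x⟩⁺_{Λ,s} ≤ β Σ_{x∈Λ}
   (⟨σ₀σ_x⟩⁺_s - m(s)²)` (step 1 and translation invariance `⟨σ_x⟩⁺_s = m(s)`), so by the hypothesis
   and the monotonicity of `m` (GKS), `(⟨σ₀⟩⁺_{Λ,h₂} - ⟨σ₀⟩⁺_{Λ,h₁}) m(h₁)⁴ ≤ βC (h₂ - h₁)` for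
   `0 < h₁ ≤ h₂ ≤ h₀` (mean value inequality); `L → ∞` gives the same for `m` (`mag_sub_mul_pow_le`).
3. *Calculus* (`pow_five_le_of_increments`): `m` is nondecreasing, `0 < m ≤ 1` on `(0,∞)`
   (`m(s) ≥ ⟨σ₀⟩^∅ ≥ tanh(βs)`, tree `dctMagInf_pos`), hence Lipschitz on `[a,b] ⊂ (0,h₀]` by step 2;
   a telescoping sum over a fine partition gives `m(b)⁵ - m(a)⁵ ≤ 5βC(b - a)`, and `a ↓ 0` with
   `m(β_c, 0⁺) = m*(β_c) = 0` (right-continuity `plusCorr_continuousWithinAt_Ici_field` and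
   `spontaneousMagnetization_criticalBeta_eq_zero_holds`) gives `m(h)⁵ ≤ 5βC h`, i.e.
   `m(h) ≤ (5βC)^{1/5} h^{1/5}`.
-/

noncomputable section

namespace Summit.CriticalPhenomena.Ising3DConformalLimit.PerfectScreeningCoulombImpliesNontrivial

open Literature.Probability.LatticeModels Filter Set Finset
open scoped Topology BigOperators
open MeasureTheory Literature.Barriers.CriticalPhenomena

/-! ### 1. Volume bound, fluctuation–response in plus boxes, the increment bound for `m` -/

section Boxes

variable {d : ℕ}

/-- **Finite-volume truncated plus correlations are bounded by the plus-state ones**: for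
`β, h ≥ 0` and `x, y ∈ box d L`,
`⟨σ_x;σ_y⟩⁺_{box L;β,h} ≤ ⟨σ_xσ_y⟩⁺_{β,h} - ⟨σ_x⟩⁺_{β,h}⟨σ_y⟩⁺_{β,h}` (GHS volume monotonicity,
tree `isingTrunc_plus_mono_volume`, and the convergence of the plus boxes on local observables). -/
theorem isingTrunc_plus_box_le_plusExpect {β h : ℝ} (hβ : 0 ≤ β) (hh : 0 ≤ h) {L : ℕ} {x y : Site d}
    (hx : x ∈ box d L) (hy : y ∈ box d L) :
    isingExpect (zdGraph d) (box d L) β h .plus (fun σ => spinAt x σ * spinAt y σ) -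
        isingExpect (zdGraph d) (box d L) β h .plus (spinAt x) *
          isingExpect (zdGraph d) (box d L) β h .plus (spinAt y) ≤
      plusExpect d β h (fun σ => spinAt x σ * spinAt y σ) -
        plusExpect d β h (spinAt x) * plusExpect d β h (spinAt y) := by
  have h2 : Tendsto (fun L' : ℕ => isingExpect (zdGraph d) (box d L') β h .plus
      (fun σ => spinAt x σ * spinAt y σ)) atTop (𝓝 (plusExpect d β h (fun σ => spinAt x σ * spinAt y σ))) :=
    tendsto_isingExpect_plus_spinFun (d := d) hβ hh {x, y} (fun s => s x * s y)
      (fun s t hst => by rw [hst x (by simp), hst y (by simp)])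
  have h1 : ∀ w : Site d, Tendsto (fun L' : ℕ => isingExpect (zdGraph d) (box d L') β h .plus (spinAt w))
      atTop (𝓝 (plusExpect d β h (spinAt w))) := fun w =>
    tendsto_isingExpect_plus_spinFun (d := d) hβ hh {w} (fun s => s w) (fun s t hst => hst w (by simp))
  refine ge_of_tendsto (h2.sub ((h1 x).mul (h1 y))) ?_
  filter_upwards [eventually_ge_atTop L] with L' hL'
  exact isingTrunc_plus_mono_volume (zdGraph d) hβ hh (box_mono d hL') hx hy

/-- **The increment bound in a plus box**: under the susceptibility hypothesis
`Σ_{x∈Λ}(⟨σ₀σ_x⟩⁺_s - m(s)²)·m(s)⁴ ≤ C` (`0 < s ≤ h₀`), for `β ≥ 0` and `0 < h₁ ≤ h₂ ≤ h₀`,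
`(⟨σ₀⟩⁺_{box L;β,h₂} - ⟨σ₀⟩⁺_{box L;β,h₁}) · m(h₁)⁴ ≤ βC (h₂ - h₁)`: fluctuation–response
`d/ds⟨σ₀⟩⁺_{Λ,s} = βΣ_{x∈Λ}⟨σ₀;σ_x⟩⁺_{Λ,s}`, the volume bound of step 1, translation invariance
`⟨σ_x⟩⁺_s = m(s)`, monotonicity of `m`, and the mean value inequality. -/
theorem boxMag_sub_mul_pow_le {β C h₀ : ℝ} (hβ : 0 ≤ β)
    (hC : ∀ h : ℝ, 0 < h → h ≤ h₀ → ∀ Λ : Finset (Site d),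
        (∑ x ∈ Λ, (plusExpect d β h (spinPair 0 x) - magnetizationInField d β h ^ 2)) *
          magnetizationInField d β h ^ 4 ≤ C)
    {h₁ h₂ : ℝ} (hh₁ : 0 < h₁) (h12 : h₁ ≤ h₂) (hh₂ : h₂ ≤ h₀) (L : ℕ) :
    (isingExpect (zdGraph d) (box d L) β h₂ .plus (spinAt 0) -
        isingExpect (zdGraph d) (box d L) β h₁ .plus (spinAt 0)) *
        magnetizationInField d β h₁ ^ 4 ≤ β * C * (h₂ - h₁) := by
  set m := magnetizationInField d β with hm
  set f : ℝ → ℝ := fun s => isingExpect (zdGraph d) (box d L) β s .plus (spinAt 0) * m h₁ ^ 4 with hf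
  have hderiv : ∀ s, HasDerivAt f ((β * ∑ y ∈ box d L,
      (isingExpect (zdGraph d) (box d L) β s .plus (fun σ => spinAt 0 σ * spinAt y σ) -
        isingExpect (zdGraph d) (box d L) β s .plus (spinAt 0) *
          isingExpect (zdGraph d) (box d L) β s .plus (spinAt y))) * m h₁ ^ 4) s :=
    fun s => (hasDerivAt_isingExpect_spinAt_field (zdGraph d) (box d L) β s .plus 0).mul_const _
  have hm0 : ∀ s, 0 ≤ s → 0 ≤ m s := fun s hs => by
    rw [hm, magnetizationInField_eq_plusCorr]; exact plusCorr_nonneg hβ hs {0}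
  have hmono : ∀ s t, 0 ≤ s → s ≤ t → m s ≤ m t := fun s t hs hst => by
    rw [hm, magnetizationInField_eq_plusCorr, magnetizationInField_eq_plusCorr]
    exact plusCorr_mono_params hβ le_rfl hs hst {0}
  have hbound : ∀ s ∈ interior (Icc h₁ h₂), deriv f s ≤ β * C := by
    intro s hs
    rw [interior_Icc] at hs
    have hs0 : 0 < s := hh₁.trans hs.1
    rw [(hderiv s).deriv]
    have hT0 : 0 ≤ ∑ y ∈ box d L,
        (isingExpect (zdGraph d) (box d L) β s .plus (fun σ => spinAt 0 σ * spinAt y σ) -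
          isingExpect (zdGraph d) (box d L) β s .plus (spinAt 0) *
            isingExpect (zdGraph d) (box d L) β s .plus (spinAt y)) :=
      Finset.sum_nonneg fun y _ => sub_nonneg.2 (ising_fkg_holds (zdGraph d) hβ (box d L) s .plus
        _ _ (spinAt_mono 0) (spinAt_mono y) (measurable_spinAt 0) (measurable_spinAt y))
    have hTle : ∑ y ∈ box d L,
        (isingExpect (zdGraph d) (box d L) β s .plus (fun σ => spinAt 0 σ * spinAt y σ) -
          isingExpect (zdGraph d) (box d L) β s .plus (spinAt 0) *
            isingExpect (zdGraph d) (box d L) β s .plus (spinAt y)) ≤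
        ∑ y ∈ box d L, (plusExpect d β s (spinPair 0 y) - m s ^ 2) := by
      refine Finset.sum_le_sum fun y hy => ?_
      refine (isingTrunc_plus_box_le_plusExpect hβ hs0.le (zero_mem_box d L) hy).trans_eq ?_
      rw [plusExpect_spinAt_eq_plusExpect_spinAt_zero (fun _ => ising_fkg_holds _) hβ s y, sq]
      rfl
    have hm4 : m h₁ ^ 4 ≤ m s ^ 4 := pow_le_pow_left₀ (hm0 h₁ hh₁.le) (hmono h₁ s hh₁.le hs.1.le) 4
    calc (β * ∑ y ∈ box d L,
          (isingExpect (zdGraph d) (box d L) β s .plus (fun σ => spinAt 0 σ * spinAt y σ) -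
            isingExpect (zdGraph d) (box d L) β s .plus (spinAt 0) *
              isingExpect (zdGraph d) (box d L) β s .plus (spinAt y))) * m h₁ ^ 4
        ≤ (β * ∑ y ∈ box d L,
          (isingExpect (zdGraph d) (box d L) β s .plus (fun σ => spinAt 0 σ * spinAt y σ) -
            isingExpect (zdGraph d) (box d L) β s .plus (spinAt 0) *
              isingExpect (zdGraph d) (box d L) β s .plus (spinAt y))) * m s ^ 4 :=
          mul_le_mul_of_nonneg_left hm4 (mul_nonneg hβ hT0)
      _ ≤ (β * ∑ y ∈ box d L, (plusExpect d β s (spinPair 0 y) - m s ^ 2)) * m s ^ 4 :=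
          mul_le_mul_of_nonneg_right (mul_le_mul_of_nonneg_left hTle hβ) (by positivity)
      _ = β * ((∑ y ∈ box d L, (plusExpect d β s (spinPair 0 y) - m s ^ 2)) * m s ^ 4) := by ring
      _ ≤ β * C := mul_le_mul_of_nonneg_left (hC s hs0 (hs.2.le.trans hh₂) (box d L)) hβ
  have hcont : ContinuousOn f (Icc h₁ h₂) := fun s _ => (hderiv s).continuousAt.continuousWithinAt
  have hdiff : DifferentiableOn ℝ f (interior (Icc h₁ h₂)) :=
    fun s _ => (hderiv s).differentiableAt.differentiableWithinAt
  have key := (convex_Icc h₁ h₂).image_sub_le_mul_sub_of_deriv_le hcont hdiff hbound h₁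
    (left_mem_Icc.2 h12) h₂ (right_mem_Icc.2 h12) h12
  calc (isingExpect (zdGraph d) (box d L) β h₂ .plus (spinAt 0) -
        isingExpect (zdGraph d) (box d L) β h₁ .plus (spinAt 0)) * m h₁ ^ 4 = f h₂ - f h₁ := by
        simp only [hf]; ring
    _ ≤ β * C * (h₂ - h₁) := key

/-- **The increment bound for the magnetisation** (`L → ∞` in `boxMag_sub_mul_pow_le`): under the
susceptibility hypothesis, `(m(h₂) - m(h₁)) · m(h₁)⁴ ≤ βC (h₂ - h₁)` for `0 < h₁ ≤ h₂ ≤ h₀`. -/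
theorem mag_sub_mul_pow_le {β C h₀ : ℝ} (hβ : 0 ≤ β)
    (hC : ∀ h : ℝ, 0 < h → h ≤ h₀ → ∀ Λ : Finset (Site d),
        (∑ x ∈ Λ, (plusExpect d β h (spinPair 0 x) - magnetizationInField d β h ^ 2)) *
          magnetizationInField d β h ^ 4 ≤ C)
    {h₁ h₂ : ℝ} (hh₁ : 0 < h₁) (h12 : h₁ ≤ h₂) (hh₂ : h₂ ≤ h₀) :
    (magnetizationInField d β h₂ - magnetizationInField d β h₁) *
        magnetizationInField d β h₁ ^ 4 ≤ β * C * (h₂ - h₁) := by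
  have hlim : ∀ s, 0 ≤ s → Tendsto (fun L : ℕ => isingExpect (zdGraph d) (box d L) β s .plus (spinAt 0))
      atTop (𝓝 (magnetizationInField d β s)) := fun s hs =>
    tendsto_isingExpect_plus_spinFun (d := d) hβ hs {0} (fun t => t 0) (fun t t' htt' => htt' 0 (by simp))
  exact le_of_tendsto (((hlim h₂ (hh₁.le.trans h12)).sub (hlim h₁ hh₁.le)).mul_const _)
    (Eventually.of_forall fun L => boxMag_sub_mul_pow_le hβ hC hh₁ h12 hh₂ L)

end Boxes

/-! ### 2. Calculus: integrating `(m(t) - m(s)) m(s)⁴ ≤ K (t - s)` to `m(h)⁵ ≤ 5 K h` -/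

section Calculus

/-- One step of the partition: for `0 < u ≤ v ≤ 1` with `(v - u) u⁴ ≤ Kδ` and `v - u ≤ Lδ`,
`v⁵ - u⁵ ≤ 5Kδ + 20 (Lδ)²`. -/
theorem pow_five_step {u v K L δ : ℝ} (hu : 0 < u) (huv : u ≤ v) (hv1 : v ≤ 1)
    (hinc : (v - u) * u ^ 4 ≤ K * δ) (hlip : v - u ≤ L * δ) :
    v ^ 5 - u ^ 5 ≤ 5 * (K * δ) + 20 * (L * δ) ^ 2 := by
  have h0 : 0 ≤ v - u := sub_nonneg.2 huv
  have hv0 : 0 ≤ v := hu.le.trans huv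
  have hu1 : u ≤ 1 := huv.trans hv1
  have hu4 : u ^ 4 ≤ v ^ 4 := pow_le_pow_left₀ hu.le huv 4
  have hk1 : u ^ 3 * v ≤ v ^ 4 := by
    calc u ^ 3 * v ≤ v ^ 3 * v := mul_le_mul_of_nonneg_right (pow_le_pow_left₀ hu.le huv 3) hv0
      _ = v ^ 4 := by ring
  have hk2 : u ^ 2 * v ^ 2 ≤ v ^ 4 := by
    calc u ^ 2 * v ^ 2 ≤ v ^ 2 * v ^ 2 :=
          mul_le_mul_of_nonneg_right (pow_le_pow_left₀ hu.le huv 2) (pow_nonneg hv0 2)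
      _ = v ^ 4 := by ring
  have hk3 : u * v ^ 3 ≤ v ^ 4 := by
    calc u * v ^ 3 ≤ v * v ^ 3 := mul_le_mul_of_nonneg_right huv (pow_nonneg hv0 3)
      _ = v ^ 4 := by ring
  have h1 : v ^ 5 - u ^ 5 ≤ 5 * (v - u) * v ^ 4 := by
    have e : v ^ 5 - u ^ 5 = (v - u) * (u ^ 4 + u ^ 3 * v + u ^ 2 * v ^ 2 + u * v ^ 3 + v ^ 4) := by
      ring
    rw [e]
    calc (v - u) * (u ^ 4 + u ^ 3 * v + u ^ 2 * v ^ 2 + u * v ^ 3 + v ^ 4)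
        ≤ (v - u) * (5 * v ^ 4) := mul_le_mul_of_nonneg_left (by linarith) h0
      _ = 5 * (v - u) * v ^ 4 := by ring
  have h2 : v ^ 4 - u ^ 4 ≤ 4 * (v - u) := by
    have e : v ^ 4 - u ^ 4 = (v - u) * (v ^ 3 + v ^ 2 * u + v * u ^ 2 + u ^ 3) := by ring
    have t1 : v ^ 3 ≤ 1 := pow_le_one₀ hv0 hv1
    have t2 : v ^ 2 * u ≤ 1 := mul_le_one₀ (pow_le_one₀ hv0 hv1) hu.le hu1
    have t3 : v * u ^ 2 ≤ 1 := mul_le_one₀ hv1 (pow_nonneg hu.le 2) (pow_le_one₀ hu.le hu1)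
    have t4 : u ^ 3 ≤ 1 := pow_le_one₀ hu.le hu1
    rw [e]
    calc (v - u) * (v ^ 3 + v ^ 2 * u + v * u ^ 2 + u ^ 3) ≤ (v - u) * 4 :=
          mul_le_mul_of_nonneg_left (by linarith) h0
      _ = 4 * (v - u) := by ring
  have h3 : (v - u) * (v ^ 4 - u ^ 4) ≤ 4 * (L * δ) ^ 2 := by
    calc (v - u) * (v ^ 4 - u ^ 4) ≤ (v - u) * (4 * (v - u)) := mul_le_mul_of_nonneg_left h2 h0
      _ = 4 * (v - u) ^ 2 := by ring
      _ ≤ 4 * (L * δ) ^ 2 := by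
          have := pow_le_pow_left₀ h0 hlip 2
          linarith
  calc v ^ 5 - u ^ 5 ≤ 5 * (v - u) * v ^ 4 := h1
    _ = 5 * ((v - u) * u ^ 4) + 5 * ((v - u) * (v ^ 4 - u ^ 4)) := by ring
    _ ≤ 5 * (K * δ) + 5 * (4 * (L * δ) ^ 2) := by linarith
    _ = 5 * (K * δ) + 20 * (L * δ) ^ 2 := by ring

/-- **The partition argument**: if `m` is nondecreasing with `0 < m(a)`, `m ≤ 1` on `[a,b]` and
`(m(t) - m(s)) m(s)⁴ ≤ K (t - s)` for `a ≤ s ≤ t ≤ b`, then `m(b)⁵ - m(a)⁵ ≤ 5K(b - a)`: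
`m` is `K/m(a)⁴`-Lipschitz on `[a,b]`, and over a partition of mesh `δ` the telescoping sum of
`pow_five_step` is `5K(b-a) + O(δ)`. -/
theorem pow_five_sub_le_of_increments {m : ℝ → ℝ} {K a b : ℝ} (ha : 0 < m a)
    (hmono : ∀ s t, a ≤ s → s ≤ t → t ≤ b → m s ≤ m t)
    (hle1 : ∀ s, a ≤ s → s ≤ b → m s ≤ 1)
    (hinc : ∀ s t, a ≤ s → s ≤ t → t ≤ b → (m t - m s) * m s ^ 4 ≤ K * (t - s))
    (hab : a ≤ b) :
    m b ^ 5 - m a ^ 5 ≤ 5 * K * (b - a) := by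
  set Lip := K / m a ^ 4 with hLip
  have hma : ∀ s, a ≤ s → s ≤ b → m a ≤ m s := fun s hs hsb => hmono a s le_rfl hs hsb
  have hlip : ∀ s t, a ≤ s → s ≤ t → t ≤ b → m t - m s ≤ Lip * (t - s) := by
    intro s t hs hst htb
    have hms4 : m a ^ 4 ≤ m s ^ 4 := pow_le_pow_left₀ ha.le (hma s hs (hst.trans htb)) 4
    have hd : 0 ≤ m t - m s := sub_nonneg.2 (hmono s t hs hst htb)
    rw [hLip, div_mul_eq_mul_div, le_div_iff₀ (pow_pos ha 4)]
    calc (m t - m s) * m a ^ 4 ≤ (m t - m s) * m s ^ 4 := mul_le_mul_of_nonneg_left hms4 hd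
      _ ≤ K * (t - s) := hinc s t hs hst htb
  have hN : ∀ N : ℕ, 0 < N →
      m b ^ 5 - m a ^ 5 ≤ 5 * K * (b - a) + 20 * (Lip * (b - a)) ^ 2 / N := by
    intro N hN
    have hN' : (0 : ℝ) < N := Nat.cast_pos.2 hN
    set δ := (b - a) / N with hδ
    have hδ0 : 0 ≤ δ := div_nonneg (sub_nonneg.2 hab) hN'.le
    set t : ℕ → ℝ := fun i => a + i * δ with ht
    have ht0 : t 0 = a := by simp [ht]
    have htN : t N = b := by
      simp only [ht, hδ]
      field_simp
      ring
    have hta : ∀ i : ℕ, a ≤ t i := fun i => by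
      simp only [ht]
      nlinarith [hδ0, (Nat.cast_nonneg i : (0 : ℝ) ≤ i)]
    have htb : ∀ i : ℕ, i ≤ N → t i ≤ b := fun i hi => by
      have h1 : (i : ℝ) * δ ≤ N * δ := mul_le_mul_of_nonneg_right (Nat.cast_le.2 hi) hδ0
      rw [← htN]
      simp only [ht]
      linarith
    have hsucc : ∀ i : ℕ, t (i + 1) - t i = δ := fun i => by
      simp only [ht, Nat.cast_add, Nat.cast_one]
      ring
    have hstep : ∀ i ∈ Finset.range N,
        m (t (i + 1)) ^ 5 - m (t i) ^ 5 ≤ 5 * (K * δ) + 20 * (Lip * δ) ^ 2 := by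
      intro i hi
      rw [Finset.mem_range] at hi
      have hii : t i ≤ t (i + 1) := by linarith [hsucc i]
      have hi1 : t (i + 1) ≤ b := htb (i + 1) hi
      refine pow_five_step (ha.trans_le (hma _ (hta i) (hii.trans hi1)))
        (hmono _ _ (hta i) hii hi1) (hle1 _ (hta _) hi1) ?_ ?_
      · have := hinc (t i) (t (i + 1)) (hta i) hii hi1
        rwa [hsucc] at this
      · have := hlip (t i) (t (i + 1)) (hta i) hii hi1
        rwa [hsucc] at this
    have htele : ∑ i ∈ Finset.range N, (m (t (i + 1)) ^ 5 - m (t i) ^ 5) = m b ^ 5 - m a ^ 5 := by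
      have := Finset.sum_range_sub (fun i => m (t i) ^ 5) N
      rwa [htN, ht0] at this
    calc m b ^ 5 - m a ^ 5 = ∑ i ∈ Finset.range N, (m (t (i + 1)) ^ 5 - m (t i) ^ 5) := htele.symm
      _ ≤ ∑ _i ∈ Finset.range N, (5 * (K * δ) + 20 * (Lip * δ) ^ 2) := Finset.sum_le_sum hstep
      _ = N * (5 * (K * δ) + 20 * (Lip * δ) ^ 2) := by
          rw [Finset.sum_const, Finset.card_range, nsmul_eq_mul]
      _ = 5 * K * (b - a) + 20 * (Lip * (b - a)) ^ 2 / N := by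
          rw [hδ]
          field_simp
  have hlim : Tendsto (fun N : ℕ => 5 * K * (b - a) + 20 * (Lip * (b - a)) ^ 2 / (N : ℝ)) atTop
      (𝓝 (5 * K * (b - a) + 0)) :=
    tendsto_const_nhds.add (tendsto_const_div_atTop_nhds_zero_nat _)
  rw [add_zero] at hlim
  exact ge_of_tendsto hlim (Filter.eventually_atTop.2 ⟨1, fun N hN1 => hN N hN1⟩)

/-- **Integration of the increment bound**: if `m` is nondecreasing and valued in `(0, 1]` on
`(0, ∞)`, `m(0⁺) = 0`, and `(m(t) - m(s)) m(s)⁴ ≤ K(t - s)` for `0 < s ≤ t ≤ h₀` (`K ≥ 0`), then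
`m(h)⁵ ≤ 5 K h` for `0 < h ≤ h₀`. -/
theorem pow_five_le_of_increments {m : ℝ → ℝ} {K h₀ : ℝ} (hK : 0 ≤ K)
    (hmono : ∀ s t, 0 < s → s ≤ t → m s ≤ m t) (hpos : ∀ s, 0 < s → 0 < m s)
    (hle1 : ∀ s, 0 < s → m s ≤ 1) (hlim : Tendsto m (𝓝[>] 0) (𝓝 0))
    (hinc : ∀ s t, 0 < s → s ≤ t → t ≤ h₀ → (m t - m s) * m s ^ 4 ≤ K * (t - s))
    {h : ℝ} (hh : 0 < h) (hh₀ : h ≤ h₀) : m h ^ 5 ≤ 5 * K * h := by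
  have hpart : ∀ a, 0 < a → a < h → m h ^ 5 ≤ m a ^ 5 + 5 * K * h := by
    intro a ha hah
    have := pow_five_sub_le_of_increments (hpos a ha)
      (fun s t hs hst _ => hmono s t (ha.trans_le hs) hst) (fun s hs _ => hle1 s (ha.trans_le hs))
      (fun s t hs hst htb => hinc s t (ha.trans_le hs) hst (htb.trans hh₀)) hah.le
    nlinarith [this, mul_nonneg hK ha.le]
  have ht : Tendsto (fun a => m a ^ 5 + 5 * K * h) (𝓝[>] 0) (𝓝 (0 ^ 5 + 5 * K * h)) :=
    (hlim.pow 5).add tendsto_const_nhds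
  rw [zero_pow (by norm_num), zero_add] at ht
  refine ge_of_tendsto ht ?_
  filter_upwards [Ioo_mem_nhdsGT hh] with a ha
  exact hpart a ha.1 ha.2

end Calculus

/-! ### 3. The stub -/

/-- **S6b — integrating the susceptibility bound** (registered stub of line `SketchPub`): if
`Σ_{x∈Λ}(⟨σ₀σ_x⟩⁺_{β_c,h} - m(β_c,h)²) · m(β_c,h)⁴ ≤ C` for all finite `Λ ⊂ ℤ³` and `0 < h ≤ h₀`,
then `m(β_c,h) ≤ A h^{1/5}` for `0 < h ≤ h₀`, with `A = (5 β_c C)^{1/5}`. Fluctuation–response in plus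
boxes, GHS volume monotonicity of truncated correlations, GKS monotonicity and positivity of `m`,
`m(β_c, 0⁺) = m*(β_c) = 0`, and the calculus of `pow_five_le_of_increments`. -/
theorem stub_upperIsothermOfSusceptibility :
    (∃ C h₀ : ℝ, 0 < h₀ ∧ ∀ h : ℝ, 0 < h → h ≤ h₀ → ∀ Λ : Finset (Site 3),
        (∑ x ∈ Λ, (plusExpect 3 (criticalBeta 3) h (spinPair 0 x) -
            magnetizationInField 3 (criticalBeta 3) h ^ 2)) *
          magnetizationInField 3 (criticalBeta 3) h ^ 4 ≤ C) →
      ∃ A h₀ : ℝ, 0 < h₀ ∧ ∀ h : ℝ, 0 < h → h ≤ h₀ →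
        magnetizationInField 3 (criticalBeta 3) h ≤ A * h ^ ((1:ℝ) / 5) := by
  rintro ⟨C, h₀, hh₀, hC⟩
  have hβ : 0 < criticalBeta 3 := criticalBeta_pos_holds (d := 3) (by norm_num)
  have hC0 : 0 ≤ C := by simpa using hC h₀ hh₀ le_rfl ∅
  have hm_eq : ∀ s, magnetizationInField 3 (criticalBeta 3) s = plusCorr 3 (criticalBeta 3) s {0} :=
    fun s => magnetizationInField_eq_plusCorr (d := 3) _ s
  have hmono : ∀ s t, 0 < s → s ≤ t →
      magnetizationInField 3 (criticalBeta 3) s ≤ magnetizationInField 3 (criticalBeta 3) t :=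
    fun s t hs hst => by
      rw [hm_eq, hm_eq]; exact plusCorr_mono_params hβ.le le_rfl hs.le hst {0}
  have hle1 : ∀ s, 0 < s → magnetizationInField 3 (criticalBeta 3) s ≤ 1 := fun s hs => by
    rw [hm_eq]; exact plusCorr_le_one hβ.le hs.le {0}
  have hpos : ∀ s, 0 < s → 0 < magnetizationInField 3 (criticalBeta 3) s := fun s hs => by
    rw [hm_eq]
    refine lt_of_lt_of_le ?_ (freeCorr_le_plusCorr hβ.le hs.le {0})
    have := dctMagInf_pos (d := 3) hβ (mul_pos hβ hs)
    rwa [dctMagInf, mul_div_cancel_left₀ _ hβ.ne'] at this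
  have hlim : Tendsto (fun s => magnetizationInField 3 (criticalBeta 3) s) (𝓝[>] 0) (𝓝 0) := by
    have h0 : plusCorr 3 (criticalBeta 3) 0 {0} = 0 := by
      rw [← hm_eq, magnetizationInField_zero]
      exact spontaneousMagnetization_criticalBeta_eq_zero_holds (d := 3) (by norm_num)
    have hc := (plusCorr_continuousWithinAt_Ici_field (d := 3) hβ.le {0} le_rfl).tendsto
    rw [h0] at hc
    simp_rw [hm_eq]
    exact hc.mono_left (nhdsWithin_mono _ Set.Ioi_subset_Ici_self)
  have hinc : ∀ s t, 0 < s → s ≤ t → t ≤ h₀ →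
      (magnetizationInField 3 (criticalBeta 3) t - magnetizationInField 3 (criticalBeta 3) s) *
        magnetizationInField 3 (criticalBeta 3) s ^ 4 ≤ criticalBeta 3 * C * (t - s) :=
    fun s t hs hst ht => mag_sub_mul_pow_le hβ.le hC hs hst ht
  refine ⟨(5 * (criticalBeta 3 * C)) ^ ((1:ℝ) / 5), h₀, hh₀, fun h hh hhh₀ => ?_⟩
  have h5 := pow_five_le_of_increments (mul_nonneg hβ.le hC0) hmono hpos hle1 hlim hinc hh hhh₀
  have hmh : 0 ≤ magnetizationInField 3 (criticalBeta 3) h := (hpos h hh).le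
  have hroot : (magnetizationInField 3 (criticalBeta 3) h ^ 5) ^ ((1:ℝ) / 5) =
      magnetizationInField 3 (criticalBeta 3) h := by
    have := Real.pow_rpow_inv_natCast hmh (show (5 : ℕ) ≠ 0 by norm_num)
    rw [one_div]
    exact_mod_cast this
  calc magnetizationInField 3 (criticalBeta 3) h
      = (magnetizationInField 3 (criticalBeta 3) h ^ 5) ^ ((1:ℝ) / 5) := hroot.symm
    _ ≤ (5 * (criticalBeta 3 * C) * h) ^ ((1:ℝ) / 5) :=
        Real.rpow_le_rpow (by positivity) h5 (by norm_num)
    _ = (5 * (criticalBeta 3 * C)) ^ ((1:ℝ) / 5) * h ^ ((1:ℝ) / 5) :=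
        Real.mul_rpow (by positivity) hh.le

end Summit.CriticalPhenomena.Ising3DConformalLimit.PerfectScreeningCoulombImpliesNontrivial

end
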